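import Literature.Computability.Cryptography.QuantumCircuitProofs
import HarnessLib

/-!
# The backward light cone of a measured wire: invariance of the acceptance probability and the width bound for local circuits of small depth

Infrastructure for the discharge of `Literature.Barriers.QuantumAdvantage.markovShi2008_cor15_anyOrder`
(Markov–Shi 2008, Cor. 1.5: logarithmic-depth `q`-local-interacting circuits are simulated
deterministically in polynomial time). The decision form of that corollary is a light-cone
statement (barrier audit, `scope_caveats (b)` of `Barriers/QuantumAdvantage/TensorNetworkContraction.lean`):
the measured wire `0` of a depth-`D` circuit that is `q`-local under a linear ordering of its
wires depends only on the `≤ 2qD + 1` wires within distance `qD` of it and on the gates inside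
that cone. This file proves the two halves of that observation for the circuit model of
`Cryptography/QuantumCircuit.lean`:

* `LightCone.cone gs S` — the **backward light cone** of the wire set `S` through the gate list
  `gs` (head = first gate): scanning the gates from the last to the first, a gate is kept, and its
  wires join the cone, iff it acts on a wire already in the cone; returns the final wire set and
  the kept gates (in their original order);
* `LightCone.SupportedOn S M` — `M` commutes with every gate placed off `S`; placed gates with
  wires in `S`, products, the acceptance projector `accProj` (wire `0` reads `1`);
* **`acceptProb_eq_acceptProb_cone`** — over a unitary gate set the acceptance probability of a
  circuit equals that of its light cone (Heisenberg picture: a gate outside the current cone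
  commutes with the observable and, being unitary, preserves the norm);
* **`card_cone_le`** — if every gate acts on wires at mutual distance `≤ q` under an ordering `σ`
  (Markov–Shi's `q`-local-interacting circuits) then the cone of one wire has at most
  `2 q D + 1` wires, `D` the ASAP depth `QCircuit.depth` (invariant `q · layer(w) + dist(w, w₀) ≤ q · D`
  along the backward scan, `cone_window`).

## References

* I. L. Markov, Y. Shi, *Simulating quantum computation by contracting tensor networks*, SIAM J.
  Comput. 38 (2008) 963–981, §1 (Cor. 1.5), §5 (Prop. 5.1: "`r = O(qD)`").
* R. Jozsa, *On the simulation of quantum circuits*, arXiv:quant-ph/0603163, §3 (remarks on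
  constant versus logarithmic range).
* M. A. Nielsen, I. L. Chuang, *Quantum Computation and Quantum Information*, CUP 2010, §2.1.7
  eq. (2.45) (operators on distinct tensor factors commute), §4.2 (circuits; the principle that
  gates after or outside the causal past of a measurement do not affect its statistics).
-/

noncomputable section

namespace Literature.Computability.QuantumComplexity

open _root_.Computability Cryptography Matrix

namespace LightCone

variable {G : QGateSet} {N : ℕ}

/-! ### The backward light cone -/

/-- **The backward light cone** of the wire set `S` through the gate list `gs` (head = first
gate to act). The gates are scanned from the last to the first; a gate whose wires meet the
current cone is kept and its wires are added to the cone, any other gate is dropped. Returns the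
final cone (a superset of `S`) and the kept gates in their original order. (Nielsen–Chuang 2010,
§4.2; the "causal cone" of a set of output wires.) [folklore] -/
def cone : List (QGate G N) → Finset (Fin N) → Finset (Fin N) × List (QGate G N)
  | [], S => (S, [])
  | g :: gs, S =>
    if Disjoint g.wires (cone gs S).1 then cone gs S
    else ((cone gs S).1 ∪ g.wires, g :: (cone gs S).2)

/-- The cone of the empty circuit. [folklore] -/
@[simp] theorem cone_nil (S : Finset (Fin N)) : cone ([] : List (QGate G N)) S = (S, []) := rfl

/-- The cone through `g :: gs`: a gate off the cone of the later gates is dropped. [folklore] -/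
theorem cone_cons_of_disjoint {g : QGate G N} {gs : List (QGate G N)} {S : Finset (Fin N)}
    (h : Disjoint g.wires (cone gs S).1) : cone (g :: gs) S = cone gs S := by
  simp [cone, h]

/-- The cone through `g :: gs`: a gate meeting the cone of the later gates is kept. [folklore] -/
theorem cone_cons_of_not_disjoint {g : QGate G N} {gs : List (QGate G N)} {S : Finset (Fin N)}
    (h : ¬ Disjoint g.wires (cone gs S).1) :
    cone (g :: gs) S = ((cone gs S).1 ∪ g.wires, g :: (cone gs S).2) := by
  simp [cone, h]

/-- The cone contains the wires it started from. [folklore] -/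
theorem subset_cone : ∀ (gs : List (QGate G N)) (S : Finset (Fin N)), S ⊆ (cone gs S).1
  | [], S => subset_rfl
  | g :: gs, S => by
    by_cases h : Disjoint g.wires (cone gs S).1
    · rw [cone_cons_of_disjoint h]; exact subset_cone gs S
    · rw [cone_cons_of_not_disjoint h]; exact (subset_cone gs S).trans Finset.subset_union_left

/-- Every kept gate acts inside the cone. [folklore] -/
theorem wires_subset_cone : ∀ (gs : List (QGate G N)) (S : Finset (Fin N)),
    ∀ g ∈ (cone gs S).2, g.wires ⊆ (cone gs S).1
  | [], S => by simp
  | g :: gs, S => by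
    intro g' hg'
    by_cases h : Disjoint g.wires (cone gs S).1
    · rw [cone_cons_of_disjoint h] at hg' ⊢; exact wires_subset_cone gs S g' hg'
    · rw [cone_cons_of_not_disjoint h] at hg' ⊢
      simp only [List.mem_cons] at hg'
      rcases hg' with rfl | hg'
      · exact Finset.subset_union_right
      · exact (wires_subset_cone gs S g' hg').trans Finset.subset_union_left

/-- The kept gates form a sublist of the circuit. [folklore] -/
theorem cone_sublist : ∀ (gs : List (QGate G N)) (S : Finset (Fin N)), (cone gs S).2.Sublist gs
  | [], S => List.Sublist.slnil
  | g :: gs, S => by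
    by_cases h : Disjoint g.wires (cone gs S).1
    · rw [cone_cons_of_disjoint h]; exact (cone_sublist gs S).cons g
    · rw [cone_cons_of_not_disjoint h]; exact (cone_sublist gs S).cons_cons g

/-- A kept gate is a gate of the circuit. [folklore] -/
theorem mem_of_mem_cone {gs : List (QGate G N)} {S : Finset (Fin N)} {g : QGate G N}
    (h : g ∈ (cone gs S).2) : g ∈ gs :=
  (cone_sublist gs S).subset h

/-- The cone has at most as many gates as the circuit. [folklore] -/
theorem length_cone_le (gs : List (QGate G N)) (S : Finset (Fin N)) : (cone gs S).2.length ≤ gs.length :=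
  (cone_sublist gs S).length_le

/-! ### Operators supported on a set of wires -/

/-- `M` is **supported on** the wire set `S`: it commutes with every gate placed on wires off `S`
(the commutation form of "`M = M_S ⊗ 1`"). (Nielsen–Chuang 2010, §2.1.7, eq. (2.45).) [folklore] -/
def SupportedOn (S : Finset (Fin N)) (M : Matrix (QReg N) (QReg N) ℂ) : Prop :=
  ∀ ⦃k : ℕ⦄ (e : Fin k ↪ Fin N) (U : Matrix (QReg k) (QReg k) ℂ),
    (∀ i, e i ∉ S) → M * placeGate e U = placeGate e U * M

/-- The identity is supported everywhere. [folklore] -/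
theorem supportedOn_one (S : Finset (Fin N)) : SupportedOn S (1 : Matrix (QReg N) (QReg N) ℂ) :=
  fun _ e U _ => by rw [Matrix.one_mul, Matrix.mul_one]

/-- Products of supported operators are supported. [folklore] -/
theorem SupportedOn.mul {S : Finset (Fin N)} {M M' : Matrix (QReg N) (QReg N) ℂ}
    (h : SupportedOn S M) (h' : SupportedOn S M') : SupportedOn S (M * M') :=
  fun _ e U he => by rw [Matrix.mul_assoc, h' e U he, ← Matrix.mul_assoc, h e U he, Matrix.mul_assoc]

/-- Support is monotone in the wire set. [folklore] -/
theorem SupportedOn.mono {S S' : Finset (Fin N)} {M : Matrix (QReg N) (QReg N) ℂ}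
    (h : SupportedOn S M) (hSS' : S ⊆ S') : SupportedOn S' M :=
  fun _ e U he => h e U fun i hi => he i (hSS' hi)

/-- A gate placed on wires inside `S` is supported on `S` (gates on disjoint wires commute,
`placeGate_comm_of_disjoint_holds`). (Nielsen–Chuang 2010, §2.1.7 eq. (2.45).) [folklore] -/
theorem supportedOn_placeGate {k : ℕ} {S : Finset (Fin N)} (e : Fin k ↪ Fin N)
    (U : Matrix (QReg k) (QReg k) ℂ) (he : ∀ i, e i ∈ S) : SupportedOn S (placeGate e U) := by
  intro k' e' V he'
  refine placeGate_comm_of_disjoint_holds e e' ?_ U V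
  rw [Set.disjoint_left]
  rintro _ ⟨i, rfl⟩ ⟨j, hj⟩
  exact he' j (hj ▸ he i)

/-- The wires of a placed gate are the range of its placement. [folklore] -/
theorem mem_wires_gate_iff (g : G.Op) (e : Fin (G.arity g) ↪ Fin N) (i : Fin N) :
    i ∈ (QGate.gate g e : QGate G N).wires ↔ ∃ j, e j = i := by
  simp [QGate.wires]

/-- The wires of a placed oracle query are the range of its placement. [folklore] -/
theorem mem_wires_oracle_iff (k : ℕ) (e : Fin (k + 1) ↪ Fin N) (i : Fin N) :
    i ∈ (QGate.oracle k e : QGate G N).wires ↔ ∃ j, e j = i := by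
  simp [QGate.wires]

/-- The matrix of a gate acting inside `S` is supported on `S`. [folklore] -/
theorem supportedOn_toMatrix (A : Language Bool) {S : Finset (Fin N)} {g : QGate G N}
    (hg : g.wires ⊆ S) : SupportedOn S (g.toMatrix A) := by
  cases g with
  | gate g e =>
    exact supportedOn_placeGate e _ fun i => hg ((mem_wires_gate_iff g e (e i)).2 ⟨i, rfl⟩)
  | oracle k e =>
    exact supportedOn_placeGate e _ fun i => hg ((mem_wires_oracle_iff k e (e i)).2 ⟨i, rfl⟩)

/-- The matrix of a gate list acting inside `S` is supported on `S`. [folklore] -/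
theorem supportedOn_toMatrix_circuit (A : Language Bool) {S : Finset (Fin N)} :
    ∀ {gs : List (QGate G N)}, (∀ g ∈ gs, g.wires ⊆ S) →
      SupportedOn S ((⟨gs⟩ : QCircuit G N).toMatrix A)
  | [], _ => by rw [QCircuit.toMatrix_nil]; exact supportedOn_one S
  | g :: gs, h => by
    rw [QCircuit.toMatrix_cons]
    exact (supportedOn_toMatrix_circuit A fun g' hg' => h g' (List.mem_cons_of_mem g hg')).mul
      (supportedOn_toMatrix A (h g List.mem_cons_self))

/-- A gate acting off `S` commutes with every operator supported on `S`. [folklore] -/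
theorem SupportedOn.comm_toMatrix (A : Language Bool) {S : Finset (Fin N)}
    {M : Matrix (QReg N) (QReg N) ℂ} (hM : SupportedOn S M) {g : QGate G N}
    (hg : Disjoint g.wires S) : M * g.toMatrix A = g.toMatrix A * M := by
  cases g with
  | gate g e =>
    exact hM e _ fun i hi =>
      Finset.disjoint_left.1 hg ((mem_wires_gate_iff g e (e i)).2 ⟨i, rfl⟩) hi
  | oracle k e =>
    exact hM e _ fun i hi =>
      Finset.disjoint_left.1 hg ((mem_wires_oracle_iff k e (e i)).2 ⟨i, rfl⟩) hi

/-! ### The acceptance projector -/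

/-- **The acceptance projector**: the diagonal projection onto the basis states whose wire `0`
reads `1`. (Nielsen–Chuang 2010, §2.2.5, measurement in the computational basis.) [folklore] -/
def accProj (hN : 0 < N) : Matrix (QReg N) (QReg N) ℂ :=
  Matrix.diagonal fun y => if y ⟨0, hN⟩ = true then 1 else 0

/-- The acceptance projector keeps the accepting amplitudes and kills the others. [folklore] -/
theorem accProj_mulVec_apply (hN : 0 < N) (v : QReg N → ℂ) (y : QReg N) :
    (accProj hN *ᵥ v) y = if y ⟨0, hN⟩ = true then v y else 0 := by
  rw [accProj, Matrix.mulVec_diagonal]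
  split_ifs <;> simp

/-- The acceptance projector is supported on the wire `0`. [folklore] -/
theorem supportedOn_accProj (hN : 0 < N) : SupportedOn ({⟨0, hN⟩} : Finset (Fin N)) (accProj hN) := by
  intro k e U he
  ext x z
  rw [accProj, Matrix.diagonal_mul, Matrix.mul_diagonal, placeGate_apply]
  by_cases hxz : ∀ i, i ∉ Set.range e → x i = z i
  · have h0 : x ⟨0, hN⟩ = z ⟨0, hN⟩ := hxz _ (by
      rintro ⟨j, hj⟩
      exact he j (Finset.mem_singleton.2 hj))
    rw [if_pos hxz, h0]
    split_ifs <;> simp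
  · rw [if_neg hxz, mul_zero, zero_mul]

/-- **The acceptance probability is the squared norm of the projected output state.**
(Nielsen–Chuang 2010, §2.2.5, `p(1) = ‖P₁ ψ‖²`.) [folklore] -/
theorem acceptProb_eq_normSq {n m : ℕ} (A : Language Bool) (C : QCircuit G (n + m)) (x : QReg n)
    (h : 0 < n + m) :
    C.acceptProb A x = normSq (accProj h *ᵥ C.runOn A (basisState (padInput x m))) := by
  unfold QCircuit.acceptProb normSq
  refine Finset.sum_congr rfl fun y _ => ?_
  rw [dif_pos h, accProj_mulVec_apply]
  split_ifs <;> simp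

/-! ### Invariance of the acceptance probability under passing to the light cone -/

/-- **Heisenberg-picture invariance of the cone.** For a unitary gate set, an operator `D`
supported on `S` and any input state `ψ`: `‖D · U(gs) ψ‖² = ‖D · U(cone of S) ψ‖²` — scanning
from the last gate, a gate off the current cone commutes with `D` and with the kept later gates
(all supported on the cone) and, being unitary, does not change the norm. (Nielsen–Chuang 2010,
§4.2 with §2.1.7 eq. (2.45).) [folklore] -/
theorem normSq_proj_toMatrix_eq_cone (hG : G.IsUnitary) (A : Language Bool) {S : Finset (Fin N)}
    {D : Matrix (QReg N) (QReg N) ℂ} (hD : SupportedOn S D) :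
    ∀ (gs : List (QGate G N)) (ψ : QReg N → ℂ),
      normSq (D *ᵥ ((⟨gs⟩ : QCircuit G N).toMatrix A *ᵥ ψ)) =
        normSq (D *ᵥ ((⟨(cone gs S).2⟩ : QCircuit G N).toMatrix A *ᵥ ψ))
  | [], ψ => rfl
  | g :: gs, ψ => by
    have ih := normSq_proj_toMatrix_eq_cone hG A hD gs (g.toMatrix A *ᵥ ψ)
    rw [QCircuit.toMatrix_cons, ← Matrix.mulVec_mulVec, ih]
    by_cases h : Disjoint g.wires (cone gs S).1
    · -- the gate is dropped: it commutes with `D · U(cone)` and preserves the norm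
      rw [cone_cons_of_disjoint h]
      have hsupp : SupportedOn (cone gs S).1 (D * (⟨(cone gs S).2⟩ : QCircuit G N).toMatrix A) :=
        (hD.mono (subset_cone gs S)).mul (supportedOn_toMatrix_circuit A (wires_subset_cone gs S))
      rw [Matrix.mulVec_mulVec, Matrix.mulVec_mulVec, hsupp.comm_toMatrix A h,
        ← Matrix.mulVec_mulVec,
        normSq_mulVec_of_mem_unitaryGroup (QGate.toMatrix_mem_unitaryGroup_holds hG A g),
        ← Matrix.mulVec_mulVec]
    · -- the gate is kept
      rw [cone_cons_of_not_disjoint h]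
      simp only
      rw [QCircuit.toMatrix_cons, ← Matrix.mulVec_mulVec]

/-- **The acceptance probability of a circuit is that of the light cone of the measured wire.**
Over a unitary gate set, for any oracle, input and ancilla count: measuring wire `0` after `C`
gives the same statistics as after the sub-circuit of the gates in the backward light cone of
wire `0`. (Nielsen–Chuang 2010, §4.2.) [folklore] -/
theorem acceptProb_eq_acceptProb_cone {n m : ℕ} (hG : G.IsUnitary) (A : Language Bool)
    (C : QCircuit G (n + m)) (x : QReg n) (h : 0 < n + m) :
    C.acceptProb A x = (⟨(cone C.gates {⟨0, h⟩}).2⟩ : QCircuit G (n + m)).acceptProb A x := by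
  rw [acceptProb_eq_normSq A C x h, acceptProb_eq_normSq A _ x h, QCircuit.runOn, QCircuit.runOn]
  exact normSq_proj_toMatrix_eq_cone hG A (supportedOn_accProj h) C.gates _

/-! ### The width of the cone of a local circuit of small depth -/

/-- ASAP layers only grow along the circuit. [folklore] -/
theorem le_depthAux (w : Fin N) : ∀ (gs : List (QGate G N)) (d : Fin N → ℕ), d w ≤ QCircuit.depthAux gs d w
  | [], d => le_rfl
  | g :: gs, d => by
    refine le_trans ?_ (le_depthAux w gs _)
    by_cases hw : w ∈ g.wires
    · simp only [hw, if_true]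
      exact (Finset.le_sup hw).trans (Nat.le_succ _)
    · simp [hw]

/-- **The window invariant of the backward scan.** If every gate of `gs` acts on wires at mutual
`σ`-distance `≤ q`, the ASAP layering started from `d` stays below `D`, then every wire `w` of
the cone of `w₀` satisfies `q · d(w) + |σ w − σ w₀| ≤ q · D` (both one-sided forms). Inductive
step: a kept gate `g` meeting the later cone at `u` has layer `ℓ = d'(u) ≥ d(w) + 1` for each of
its wires `w`, and `|σ w − σ u| ≤ q`. (Markov–Shi 2008, §5: "`r = O(qD)`"; Jozsa 2006, §3.)
[folklore] -/
theorem cone_window (σ : Fin N ≃ Fin N) (q : ℕ) (w₀ : Fin N) (D : ℕ) :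
    ∀ (gs : List (QGate G N)) (d : Fin N → ℕ),
      (∀ g ∈ gs, ∀ i ∈ g.wires, ∀ j ∈ g.wires, ((σ i : Fin N) : ℕ) ≤ ((σ j : Fin N) : ℕ) + q) →
      (∀ w, QCircuit.depthAux gs d w ≤ D) →
      ∀ w ∈ (cone gs {w₀}).1,
        q * d w + ((σ w : Fin N) : ℕ) ≤ q * D + ((σ w₀ : Fin N) : ℕ) ∧
          q * d w + ((σ w₀ : Fin N) : ℕ) ≤ q * D + ((σ w : Fin N) : ℕ)
  | [], d, _, hD, w, hw => by
    simp only [cone_nil, Finset.mem_singleton] at hw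
    subst hw
    have := Nat.mul_le_mul_left q (hD w)
    exact ⟨by simpa [QCircuit.depthAux] using this, by simpa [QCircuit.depthAux] using this⟩
  | g :: gs, d, hloc, hD, w, hw => by
    set d' : Fin N → ℕ := fun i => if i ∈ g.wires then g.wires.sup d + 1 else d i with hd'
    have hD' : ∀ w, QCircuit.depthAux gs d' w ≤ D := hD
    have ih := cone_window σ q w₀ D gs d' (fun g' hg' => hloc g' (List.mem_cons_of_mem g hg')) hD'
    have hdd' : ∀ i, d i ≤ d' i := fun i => by
      by_cases hi : i ∈ g.wires
      · simp only [hd', hi, if_true]; exact (Finset.le_sup hi).trans (Nat.le_succ _)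
      · simp [hd', hi]
    have hmono : ∀ i ∈ (cone gs {w₀}).1,
        q * d i + ((σ i : Fin N) : ℕ) ≤ q * D + ((σ w₀ : Fin N) : ℕ) ∧
          q * d i + ((σ w₀ : Fin N) : ℕ) ≤ q * D + ((σ i : Fin N) : ℕ) := fun i hi => by
      have h1 := ih i hi
      have h2 := Nat.mul_le_mul_left q (hdd' i)
      omega
    by_cases h : Disjoint g.wires (cone gs {w₀}).1
    · rw [cone_cons_of_disjoint h] at hw
      exact hmono w hw
    · rw [cone_cons_of_not_disjoint h] at hw
      simp only [Finset.mem_union] at hw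
      rcases hw with hw | hw
      · exact hmono w hw
      · -- `w` is a wire of the kept gate `g`, which meets the later cone at some `u`
        obtain ⟨u, hug, huc⟩ : ∃ u ∈ g.wires, u ∈ (cone gs {w₀}).1 := by
          simpa [Finset.not_disjoint_iff] using h
        have hu := ih u huc
        have hdu : d' u = g.wires.sup d + 1 := by simp [hd', hug]
        have hdw : d w ≤ g.wires.sup d := Finset.le_sup hw
        have hl1 := hloc g List.mem_cons_self w hw u hug
        have hl2 := hloc g List.mem_cons_self u hug w hw
        rw [hdu] at hu
        have h3 : q * d w + q ≤ q * (g.wires.sup d + 1) := by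
          rw [Nat.mul_succ]; exact Nat.add_le_add_right (Nat.mul_le_mul_left q hdw) q
        omega

/-- At most `r + 1 + r` wires have their `σ`-position within `r` of that of `w₀`. [folklore] -/
theorem card_window_le' (σ : Fin N ≃ Fin N) (w₀ : Fin N) (r : ℕ) :
    (Finset.univ.filter fun w : Fin N =>
        ((σ w : Fin N) : ℕ) ≤ r + ((σ w₀ : Fin N) : ℕ) ∧
          ((σ w₀ : Fin N) : ℕ) ≤ r + ((σ w : Fin N) : ℕ)).card ≤ 2 * r + 1 := by
  classical
  calc (Finset.univ.filter fun w : Fin N =>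
          ((σ w : Fin N) : ℕ) ≤ r + ((σ w₀ : Fin N) : ℕ) ∧
            ((σ w₀ : Fin N) : ℕ) ≤ r + ((σ w : Fin N) : ℕ)).card
      ≤ (Finset.Icc (((σ w₀ : Fin N) : ℕ) - r) (((σ w₀ : Fin N) : ℕ) + r)).card := by
        refine Finset.card_le_card_of_injOn (fun w => ((σ w : Fin N) : ℕ)) ?_ ?_
        · intro w hw
          simp only [Finset.coe_filter, Finset.mem_univ, true_and, Set.mem_setOf_eq] at hw
          simp only [Finset.coe_Icc, Set.mem_Icc]
          omega
        · intro w _ w' _ hww'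
          exact σ.injective (Fin.ext hww')
    _ = ((σ w₀ : Fin N) : ℕ) + r + 1 - (((σ w₀ : Fin N) : ℕ) - r) := Nat.card_Icc _ _
    _ ≤ 2 * r + 1 := by omega

/-- **The light cone of one wire of a `q`-local circuit of depth `D` has at most `2qD + 1`
wires.** If every gate of `C` acts on wires at mutual distance `≤ q` under the linear ordering
`σ` (a `q`-local-interacting circuit in the sense of Markov–Shi) then the backward light cone of
any single wire `w₀` consists of wires whose `σ`-positions lie within `q · depth C` of that of
`w₀`. (Markov–Shi 2008, §1 Cor. 1.5 and §5, "`r = O(qD)`"; Jozsa 2006, §3.) [folklore] -/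
theorem card_cone_le (σ : Fin N ≃ Fin N) (q : ℕ) (C : QCircuit G N)
    (hloc : ∀ g ∈ C.gates, ∀ i ∈ g.wires, ∀ j ∈ g.wires, ((σ i : Fin N) : ℕ) ≤ ((σ j : Fin N) : ℕ) + q)
    (w₀ : Fin N) : ((cone C.gates {w₀}).1).card ≤ 2 * (q * C.depth) + 1 := by
  classical
  have hwin := cone_window σ q w₀ C.depth C.gates (fun _ => 0) hloc
    (fun w => Finset.le_sup (f := QCircuit.depthAux C.gates fun _ => 0) (Finset.mem_univ w))
  refine le_trans (Finset.card_le_card ?_) (card_window_le' σ w₀ (q * C.depth))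
  intro w hw
  have := hwin w hw
  simp only [Finset.mem_filter, Finset.mem_univ, true_and]
  omega

end LightCone

end Literature.Computability.QuantumComplexity

end
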